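import Literature.Computability.Complexity.F2RowReduction
import HarnessLib

/-!
# Row reduction over `𝔽₂` on bit lists, II: rank, the kernel parametrisation and dual vectors

Sequel of `F2RowReduction.lean` (`F2Elim.rrun`, invariant `Inv`, kernel vectors `kvec`, K1–K3). For the
reduced form `S = rrun n M` of a list `M` of bit rows this file adds the three facts a SAMPLER over the
solution set of an affine system `{x | x · v = φ v ∀ v ∈ rowSpan M}` needs:

* **rank** (`finrank_rowSpan_eq_card_pivs`): the pivot rows are a basis of the row span, so
  `finrank (rowSpan n M) = #pivs`, and `#pivs + #frees = n` (`card_pivs_add_card_frees`);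
* **the kernel parametrisation** `w ↦ Σ_{f free} [w_f] · kvec f` from `{0,1}ⁿ` onto `ker M`: its values lie
  in the kernel (`sum_smul_kvec_mem_kerSet`), its value determines the free coordinates of `w` and nothing
  else (`sum_smul_kvec_eq_iff`), so every kernel vector has exactly `2^{#pivs}` preimages
  (`card_filter_sum_smul_kvec_eq`);
* **dual vectors from pivot values** (`dotZ_dualVec_eq`): a function `φ` additive on the row span is the
  functional `v ↦ x₀ · v` for the vector `x₀` carrying `φ(pivot row of c)` at each pivot column `c` and `0`
  at the free columns (kept INLINE as `fun c => if isPiv S c then φ (prow S c) else 0`, no new definition);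
  and the set of all such representing vectors is the coset `x₀ + ker M` (`forall_dotZ_eq_iff_add_mem_kerSet`).

## References

* J. von zur Gathen, J. Gerhard, *Modern Computer Algebra*, 3rd ed., CUP 2013, §12.1 (reduced row echelon
  form: rank, kernel basis). [VonzurgathenGerhard2013]
* D. E. Knuth, *The Art of Computer Programming*, Vol. 2, 3rd ed., §4.6.2, Algorithm N (null space).
  [KnuthTAOCP2]
-/

namespace Literature.Computability.Complexity

namespace F2Elim

open Finset
open BLR (toZ toZ_xor toZ_injective)

variable {n : ℕ} {M : List (List Bool)}

/-! ### Rank: the pivot rows are a basis of the row span -/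

/-- `#pivs + #frees = n`. [folklore] -/
theorem card_pivs_add_card_frees (n : ℕ) (S : List Row) : (pivs n S).card + (frees n S).card = n := by
  rw [frees_eq_filter_not, pivs, Finset.card_filter_add_card_filter_not, card_univ, Fintype.card_fin]

/-- Under the invariant the row span of the state is the row span of `M`. [cite: VonzurgathenGerhard2013, §12.1] -/
theorem rowSpan_rows_eq {t : ℕ} {S : List Row} (hS : Inv n t M S) : rowSpan n (rowsOf S) = rowSpan n M := by
  refine le_antisymm (rowSpan_rows_le hS) (Submodule.span_le.2 ?_)
  rintro v ⟨r, hr, rfl⟩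
  exact hS.span₂ r hr

/-- At a pivot column of a fully swept state, `prow` is a row of the state labelled by that column.
[folklore] -/
theorem mem_prow {S : List Row} {c : ℕ} (h : isPiv S c = true) : (some c, prow S c) ∈ S :=
  mem_of_pivRow (pivRow_eq_some_prow h)

/-- The row span of a fully swept state is spanned by its pivot rows. [cite: VonzurgathenGerhard2013, §12.1] -/
theorem rowSpan_rows_eq_span_prow {S : List Row} (hS : Inv n n M S) :
    rowSpan n (rowsOf S) = Submodule.span (ZMod 2) (Set.range fun c : pivs n S => vecZ n (prow S c)) := by
  refine le_antisymm (Submodule.span_le.2 ?_) (Submodule.span_mono ?_)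
  · rintro v ⟨r, hr, rfl⟩
    obtain ⟨x, hx, rfl⟩ := mem_rowsOf_iff.1 hr
    obtain ⟨l, r⟩ := x
    cases l with
    | none => rw [vecZ_unlab hS hx]; exact Submodule.zero_mem _
    | some c =>
      have hcn : c < n := label_lt hS hx
      have hp : isPiv S c = true := isPiv_iff.2 ⟨_, hx, rfl⟩
      have hpr : prow S c = r := by
        have h1 := pivRow_eq_of_mem hS hx
        rw [prow, h1]; rfl
      refine Submodule.subset_span ⟨⟨⟨c, hcn⟩, mem_pivs.2 hp⟩, ?_⟩
      simp only [hpr]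
  · rintro v ⟨c, rfl⟩
    exact ⟨prow S c, mem_rowsOf (mem_prow (mem_pivs.1 c.2)), rfl⟩

/-- Coordinates of a combination of pivot rows at a pivot column: the coefficient of that column.
[folklore] -/
theorem sum_smul_prow_apply_piv {S : List Row} (hS : Inv n n M S) (s : Finset (pivs n S)) (g : pivs n S → ZMod 2)
    (c : pivs n S) (hc : c ∈ s) : (∑ c' ∈ s, g c' • vecZ n (prow S c')) c = g c := by
  rw [Finset.sum_apply]
  simp only [Pi.smul_apply, smul_eq_mul]
  have e : ∀ c' ∈ s, g c' * vecZ n (prow S c') c = if c' = c then g c else 0 := by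
    intro c' _
    rw [vecZ_pivRow hS (pivRow_eq_some_prow (mem_pivs.1 c'.2)), if_pos (mem_pivs.1 c.2), add_zero]
    by_cases h : c' = c
    · subst h; simp
    · have h' : (c : Fin n) ≠ (c' : Fin n) := fun e => h (Subtype.ext e.symm)
      rw [if_neg h', if_neg h, mul_zero]
  rw [sum_congr rfl e, sum_ite_eq' s c, if_pos hc]

/-- **The pivot rows are linearly independent.** [cite: VonzurgathenGerhard2013, §12.1] -/
theorem linearIndependent_prow {S : List Row} (hS : Inv n n M S) :
    LinearIndependent (ZMod 2) (fun c : pivs n S => vecZ n (prow S c)) := by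
  rw [linearIndependent_iff']
  intro s g hg c hc
  have := congrFun hg c
  rwa [sum_smul_prow_apply_piv hS s g c hc] at this

/-- **Rank = number of pivots**: the dimension of the row span of `M` over `𝔽₂` is the number of pivot
columns of its reduced form. [cite: VonzurgathenGerhard2013, §12.1] -/
theorem finrank_rowSpan_eq_card_pivs (n : ℕ) (M : List (List Bool)) :
    Module.finrank (ZMod 2) (rowSpan n M) = (pivs n (rrun n M)).card := by
  have hS := inv_rrun n n M
  rw [← rowSpan_rows_eq hS, rowSpan_rows_eq_span_prow hS, finrank_span_eq_card (linearIndependent_prow hS),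
    Fintype.card_coe]

/-- Counting a Boolean predicate along `List.range n` is counting it over `Fin n`. [folklore] -/
theorem length_filter_range_eq_card (p : ℕ → Bool) (n : ℕ) :
    ((List.range n).filter p).length = (univ.filter fun c : Fin n => p c = true).card := by
  have h : ∀ m : ℕ, ((List.range m).filter p).length = ∑ i ∈ Finset.range m, if p i = true then 1 else 0 := by
    intro m
    induction m with
    | zero => simp
    | succ m ih =>
      rw [List.range_succ, List.filter_append, List.length_append, ih, Finset.sum_range_succ]
      congr 1
      cases hp : p m <;> simp [hp]
  rw [h, Finset.card_filter, ← Fin.sum_univ_eq_sum_range (fun i => if p i = true then 1 else 0) n]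

/-- The number of pivot columns, counted along `List.range`. [folklore] -/
theorem length_filter_isPiv (n : ℕ) (S : List Row) :
    ((List.range n).filter fun c => isPiv S c).length = (pivs n S).card :=
  length_filter_range_eq_card _ n

/-! ### The kernel parametrisation `w ↦ Σ_{f free} [w_f] · kvec f` -/

/-- The kernel is closed under the combinations used below: a combination of the kernel vectors of free
columns lies in `ker M` (K1 and linearity of the dot product). [cite: KnuthTAOCP2, §4.6.2 Algorithm N] -/
theorem sum_smul_kvec_mem_kerSet (a : Fin n → ZMod 2) :
    ∑ f ∈ frees n (rrun n M), a f • vecZ n (kvec n (rrun n M) f) ∈ kerSet n M := by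
  intro r hr
  rw [dotZ_comm, dotZ_sum_left]
  refine Finset.sum_eq_zero fun f hf => ?_
  rw [dotZ_smul_left, dotZ_comm, vecZ_kvec_mem_kerSet (mem_frees.1 hf) r hr, mul_zero]

/-- The free coordinates of a combination of kernel vectors are its coefficients. [cite: KnuthTAOCP2, §4.6.2 Algorithm N] -/
theorem sum_smul_kvec_apply_free {S : List Row} (a : Fin n → ZMod 2) {f' : Fin n} (hf' : isPiv S f' = false) :
    (∑ f ∈ frees n S, a f • vecZ n (kvec n S f)) f' = a f' := by
  rw [Finset.sum_apply]
  simp only [Pi.smul_apply, smul_eq_mul]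
  have e : ∀ f ∈ frees n S, a f * vecZ n (kvec n S f) f' = if f = f' then a f' else 0 := by
    intro f hf
    rw [vecZ_kvec (mem_frees.1 hf)]
    have h2 : (if isPiv S f' = true then toZ (pe S f' f) else 0) = 0 := if_neg (by rw [hf']; exact Bool.false_ne_true)
    rw [h2, add_zero]
    by_cases h : f = f'
    · subst h; simp
    · rw [if_neg (Ne.symm h), if_neg h, mul_zero]
  rw [sum_congr rfl e, sum_ite_eq' (frees n S) f', if_pos (mem_frees.2 hf')]

/-- **A kernel vector is hit exactly by the coefficient vectors agreeing with it on the free columns.**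
[cite: KnuthTAOCP2, §4.6.2 Algorithm N] -/
theorem sum_smul_kvec_eq_iff (a : Fin n → ZMod 2) {d : Fin n → ZMod 2} (hd : d ∈ kerSet n M) :
    ∑ f ∈ frees n (rrun n M), a f • vecZ n (kvec n (rrun n M) f) = d ↔ ∀ f ∈ frees n (rrun n M), a f = d f := by
  constructor
  · intro h f hf
    rw [← h, sum_smul_kvec_apply_free a (mem_frees.1 hf)]
  · intro h
    rw [eq_sum_kvec_of_mem_kerSet hd]
    exact sum_congr rfl fun f hf => by rw [h f hf]

/-- `toZ b = a ↔ b = [a = 1]`. [folklore] -/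
theorem toZ_eq_iff (b : Bool) (a : ZMod 2) : toZ b = a ↔ b = decide (a = 1) := by
  rcases toZ_surjective a with ⟨c, rfl⟩
  cases b <;> cases c <;> decide

/-- **Fibres of the kernel parametrisation**: every kernel vector `d` has exactly `2^{#pivs}` coefficient
vectors `w ∈ {0,1}ⁿ` with `Σ_{f free} [w_f] · kvec f = d` (the free coordinates are forced, the pivot
coordinates are arbitrary). [cite: KnuthTAOCP2, §4.6.2 Algorithm N] -/
theorem card_filter_sum_smul_kvec_eq {d : Fin n → ZMod 2} (hd : d ∈ kerSet n M) :
    (univ.filter fun w : Fin n → Bool =>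
        ∑ f ∈ frees n (rrun n M), toZ (w f) • vecZ n (kvec n (rrun n M) f) = d).card =
      2 ^ (pivs n (rrun n M)).card := by
  classical
  set S := rrun n M with hSdef
  have hset : (univ.filter fun w : Fin n → Bool => ∑ f ∈ frees n S, toZ (w f) • vecZ n (kvec n S f) = d) =
      Fintype.piFinset fun i : Fin n => if isPiv S i = false then {decide (d i = 1)} else (univ : Finset Bool) := by
    ext w
    rw [mem_filter, Fintype.mem_piFinset, sum_smul_kvec_eq_iff (fun f => toZ (w f)) hd]
    simp only [mem_univ, true_and]
    constructor
    · intro h i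
      by_cases hi : isPiv S i = false
      · rw [if_pos hi, mem_singleton, ← toZ_eq_iff]; exact h i (mem_frees.2 hi)
      · rw [if_neg hi]; exact mem_univ _
    · intro h f hf
      have := h f
      rw [if_pos (mem_frees.1 hf), mem_singleton, ← toZ_eq_iff] at this
      exact this
  rw [hset, Fintype.card_piFinset]
  have e : ∀ i : Fin n, ((if isPiv S i = false then {decide (d i = 1)} else (univ : Finset Bool)).card : ℕ) =
      if isPiv S i = true then 2 else 1 := by
    intro i
    cases isPiv S i <;> simp
  rw [prod_congr rfl fun i _ => e i, prod_ite, prod_const, prod_const_one, mul_one]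
  rfl

/-! ### Dual vectors from the values on the pivot rows -/

/-- The DUAL VECTOR of a function `φ` on `𝔽₂ⁿ` with respect to a swept state `S` is the vector
`x₀ = fun c => if isPiv S c then φ (prow S c) else 0` carrying `φ(pivot row of c)` at the pivot columns and
`0` at the free columns (written inline below). It pairs with a pivot row to the prescribed value.
[cite: VonzurgathenGerhard2013, §12.1] -/
theorem dotZ_dualVec_prow {S : List Row} (hS : Inv n n M S) (φ : (Fin n → ZMod 2) → ZMod 2) {c : Fin n}
    (hc : isPiv S c = true) :
    dotZ (fun c => if isPiv S c = true then φ (vecZ n (prow S c)) else 0) (vecZ n (prow S c)) =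
      φ (vecZ n (prow S c)) := by
  rw [dotZ_comm, dotZ_pivRow hS (pivRow_eq_some_prow hc)]
  have h0 : ∑ f ∈ frees n S, toZ (pe S c f) * (fun c : Fin n => if isPiv S c = true then φ (vecZ n (prow S c)) else 0) f = 0 :=
    Finset.sum_eq_zero fun f hf => by
      simp only [if_neg (show ¬ isPiv S f = true by rw [mem_frees.1 hf]; exact Bool.false_ne_true), mul_zero]
  rw [h0, add_zero]
  exact if_pos hc

/-- **Dual vectors.** If `φ` vanishes at `0` and is additive on the row span of `M`, then
`x₀ · v = φ v` for every `v` in the row span, where `x₀` is the dual vector read off the reduced form.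
[cite: VonzurgathenGerhard2013, §12.1] -/
theorem dotZ_dualVec_eq (φ : (Fin n → ZMod 2) → ZMod 2) (h0 : φ 0 = 0)
    (hadd : ∀ u ∈ rowSpan n M, ∀ v ∈ rowSpan n M, φ (u + v) = φ u + φ v)
    {v : Fin n → ZMod 2} (hv : v ∈ rowSpan n M) :
    dotZ (fun c => if isPiv (rrun n M) c = true then φ (vecZ n (prow (rrun n M) c)) else 0) v = φ v := by
  have hS := inv_rrun n n M
  rw [← rowSpan_rows_eq hS] at hv
  induction hv using Submodule.span_induction with
  | mem u hu =>
    obtain ⟨r, hr, rfl⟩ := hu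
    obtain ⟨x, hx, rfl⟩ := mem_rowsOf_iff.1 hr
    obtain ⟨l, r⟩ := x
    cases l with
    | none => rw [vecZ_unlab hS hx, h0, dotZ_comm, dotZ_zero_left]
    | some c =>
      have hcn : c < n := label_lt hS hx
      have hp : isPiv (rrun n M) c = true := isPiv_iff.2 ⟨_, hx, rfl⟩
      have hpr : prow (rrun n M) c = r := by rw [prow, pivRow_eq_of_mem hS hx]; rfl
      have := dotZ_dualVec_prow hS φ (c := ⟨c, hcn⟩) hp
      rwa [show ((⟨c, hcn⟩ : Fin n) : ℕ) = c from rfl, hpr] at this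
  | zero => rw [h0, dotZ_comm, dotZ_zero_left]
  | add u w hu hw ihu ihw =>
    have hu' : u ∈ rowSpan n M := by rw [← rowSpan_rows_eq hS]; exact hu
    have hw' : w ∈ rowSpan n M := by rw [← rowSpan_rows_eq hS]; exact hw
    rw [dotZ_add_right, ihu, ihw, hadd u hu' w hw']
  | smul a u _hu ihu =>
    rcases toZ_surjective a with ⟨b, rfl⟩
    cases b
    · rw [show toZ false = 0 from rfl, zero_smul, h0, dotZ_comm, dotZ_zero_left]
    · rw [show toZ true = 1 from rfl, one_smul, ihu]

/-- **The representing vectors of `φ` form the coset `x₀ + ker M`**: `x · v = φ v` on the whole row span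
iff `x + x₀ ∈ ker M`. [cite: VonzurgathenGerhard2013, §12.1] -/
theorem forall_dotZ_eq_iff_add_mem_kerSet (φ : (Fin n → ZMod 2) → ZMod 2) (h0 : φ 0 = 0)
    (hadd : ∀ u ∈ rowSpan n M, ∀ v ∈ rowSpan n M, φ (u + v) = φ u + φ v) (x : Fin n → ZMod 2) :
    (∀ v ∈ rowSpan n M, dotZ x v = φ v) ↔
      x + (fun c : Fin n => if isPiv (rrun n M) c = true then φ (vecZ n (prow (rrun n M) c)) else 0) ∈ kerSet n M := by
  constructor
  · intro h r hr
    have hv : vecZ n r ∈ rowSpan n M := vecZ_mem_rowSpan hr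
    rw [dotZ_comm, dotZ_add_left, h _ hv, dotZ_dualVec_eq φ h0 hadd hv, CharTwo.add_self_eq_zero]
  · intro h v hv
    have h1 : dotZ (x + fun c : Fin n => if isPiv (rrun n M) c = true then φ (vecZ n (prow (rrun n M) c)) else 0) v = 0 := by
      rw [dotZ_comm]; exact dotZ_eq_zero_of_mem_rowSpan hv h
    rw [dotZ_add_left, dotZ_dualVec_eq φ h0 hadd hv] at h1
    exact (CharTwo.add_eq_zero (R := ZMod 2)).1 h1

end F2Elim

end Literature.Computability.Complexity
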